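import Summits.Ventures.PercRepro.Night2SeriesClassesThreeOneFSCells
import Summits.Ventures.PercRepro.Night2SeriesClassesThreeOneCellsF

/-!
# PercRepro — **THE `(7, 5)` SHADOW ROW MODULO THE RESIDUES S**: the `(3, 1)` range shrinks to `11 ≤ |G| ≤ 15`
(night-2, gen 23)

With the face-sum budget with coloops (`Night2SeriesClassesThreeOneFSCells`): at `|G| = 16, 17` the single surviving
fat pair closes, at `|G| = 11` two disjoint fat pairs close, at `|G| = 15` the triangle closes.
`shadowHall_seven_five_of_residuesS`: the residues R with `|G| ≤ 15`, «`|G| = 11` → one fat thin closure»,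
«`12 ≤ |G| ≤ 14` → three closures form a triangle», «`|G| = 15` → at most two».
-/

namespace PercRepro.Shadow

open Finset PerFlat ThmH

section SevenFiveS

variable {α' : Type} [DecidableEq α']

/-- **THE `(7, 5)` SHADOW ROW FOR EVERY FINITE MATROID MODULO THE RESIDUES S**. -/
theorem shadowHall_seven_five_of_residuesS
    (h20 : ∀ (N : Matroid α') [N.Finite] (G : Finset α'), CellHyp N G →
      (gr N \ G).card = 2 → kColoops N G = 0 → FatMember N G 6 3 →
      (FatBasis N G 6 2 ∨ FatMember N G 6 2) → LocalShadowHall N 5 G)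
    (h21 : ∀ (N : Matroid α') [N.Finite] (G : Finset α'), CellHyp N G →
      (gr N \ G).card = 2 → kColoops N G = 1 → FatMember N G 5 4 →
      (FatBasis N G 5 3 ∨ FatMember N G 5 3) → LocalShadowHall N 5 G)
    (h31 : ∀ (N : Matroid α') [N.Finite] (G : Finset α'), CellHyp N G →
      (gr N \ G).card = 3 → kColoops N G = 1 → 11 ≤ G.card → G.card ≤ 15 → FatMember N G 5 2 →
      (11 ≤ G.card ∧ G.card ≤ 17 → NoThreeDisjointFat N G 2) →
      (G.card = 11 ∨ G.card = 15 ∨ G.card = 16 → FatBasis N G 5 3) →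
      (12 ≤ G.card ∧ G.card ≤ 14 → FatBasis N G 5 4) →
      (fatClosures N 5 G 2).card ≤ 3 → (G.card = 11 → (fatClosures N 5 G 2).card ≤ 1) →
      (12 ≤ G.card ∧ G.card ≤ 14 → TriangleFat N G 2) → (G.card = 15 → (fatClosures N 5 G 2).card ≤ 2) →
      LocalShadowHall N 5 G)
    (h32 : ∀ (N : Matroid α') [N.Finite] (G : Finset α'), CellHyp N G →
      (gr N \ G).card = 3 → kColoops N G = 2 → FatMember N G 4 2 → LocalShadowHall N 5 G)
    (M : Matroid α') [M.Finite] : ShadowHall M 7 5 (phiK 7 5) := by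
  apply shadowHall_seven_five_of_residuesR h20 h21 _ h32
  intro N _ G hcell hd hk h11 h17 hfm _ _ _ cnd3 cb3 cb4 hc3 hc11 hc1215 hc16
  have hG := hcell.2.2.2
  have hd' : (gr N \ G).card ≤ 5 := by omega
  have hc : ∀ {B : Finset α'}, B ∈ thinMembers N 5 G → (G \ clF N B).card ≤ 2 → (G \ clF N B).card = 2 :=
    fun hB hle => le_antisymm hle
      (two_le_card_sdiff_of_not_lay0 hG hd' (mem_thinMembers.1 hB).1 (mem_thinMembers.1 hB).2)
  have hpair : ∀ {B : Finset α'}, B ∈ thinMembers N 5 G → (G \ clF N B).card ≤ 2 →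
      ∃ p x : α', p ≠ x ∧ G \ clF N B = {p, x} ∧ (∀ a ∈ ({p, x} : Finset α'), a ∉ coloops N G) ∧
        N.eRk ((G \ {p, x} : Finset α') : Set α') ≤ ((5 : ℕ) : ℕ∞) := by
    intro B hB hf
    obtain ⟨p, x, hpx, hP⟩ := Finset.card_eq_two.1 (hc hB hf)
    refine ⟨p, x, hpx, hP, ?_, ?_⟩
    · intro a ha
      exact notMem_coloops_of_mem_sdiff_clF hG hd' hB (hP ▸ ha)
    · have := eRk_clF_le_of_mem_thinMembers hB
      rwa [clF_eq_sdiff_sdiff_of_thin hB, hP] at this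
  rcases (show 16 ≤ G.card ∨ G.card = 11 ∨ G.card = 15 ∨ (12 ≤ G.card ∧ G.card ≤ 14) by omega) with hN | hN | hN | hN
  · -- `|G| = 16, 17`: one fat pair
    have hfm' := hfm
    obtain ⟨B₀, hB₀, -, hfat⟩ := hfm'
    obtain ⟨p, x, hpx, -, hK, hH₀⟩ := hpair hB₀ hfat
    rcases (show G.card = 16 ∨ G.card = 17 by omega) with h16 | h17'
    · exact localShadowHall_three_one_five_sixteen_of_pairFS hG hd hk hcell.1 hcell.2.1 h16 (hc16 hN) hpx hK hH₀
    · exact localShadowHall_three_one_five_seventeen_of_pairFS hG hd hk hcell.1 hcell.2.1 h17' (hc16 hN) hpx hK hH₀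
  · -- `|G| = 11`: two disjoint fat pairs close
    obtain ⟨hle2, hnm⟩ := hc11 hN
    by_cases h1 : (fatClosures N 5 G 2).card ≤ 1
    · exact h31 N G hcell hd hk h11 (by omega) hfm cnd3 cb3 cb4 hc3 (fun _ => h1) (fun h => absurd h.1 (by omega))
        (fun h => absurd h (by omega))
    · obtain ⟨B₀, hB₀, B₁, hB₁, hf₀, hf₁, hne⟩ :=
        exists_twoFat_of_one_lt_card_fatClosures (M := N) (q := 5) (G := G) (by omega)
      have hdis := hnm B₀ hB₀ B₁ hB₁ hf₀ hf₁ hne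
      obtain ⟨p, x, hpx, hP₀, hK₀, hH₀⟩ := hpair hB₀ hf₀
      obtain ⟨u, v, huv, hP₁, hK₁, hH₁⟩ := hpair hB₁ hf₁
      have hdisj : Disjoint ({p, x} : Finset α') {u, v} := by
        rw [Finset.disjoint_left]
        intro z hz hz'
        have : z ∈ (G \ clF N B₀) ∩ (G \ clF N B₁) := Finset.mem_inter.2 ⟨hP₀ ▸ hz, hP₁ ▸ hz'⟩
        rw [hdis] at this
        exact Finset.notMem_empty z this
      refine localShadowHall_three_one_five_eleven_of_twoPairsFS hG hd hk hcell.1 hcell.2.1 hN hle2 hpx huv hdisj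
        ?_ hH₀ hH₁
      intro a ha
      simp only [Finset.mem_insert, Finset.mem_singleton] at ha
      rcases ha with rfl | rfl | rfl | rfl
      · exact hK₀ _ (by simp)
      · exact hK₀ _ (by simp)
      · exact hK₁ _ (by simp)
      · exact hK₁ _ (by simp)
  · -- `|G| = 15`: the triangle closes
    have htri := hc1215 ⟨by omega, by omega⟩
    by_cases h2 : (fatClosures N 5 G 2).card ≤ 2
    · exact h31 N G hcell hd hk h11 (by omega) hfm cnd3 cb3 cb4 hc3 (fun h => absurd h (by omega))
        (fun h => absurd h.2 (by omega)) (fun _ => h2)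
    · obtain ⟨B₀, hB₀, B₁, hB₁, B₂, hB₂, hf₀, hf₁, hf₂, h01, h02, h12⟩ :=
        exists_threeFat_of_two_lt_card_fatClosures (M := N) (q := 5) (G := G) (by omega)
      have hU := htri B₀ hB₀ B₁ hB₁ B₂ hB₂ hf₀ hf₁ hf₂ h01 h02 h12
      -- two of the three pairs share a point
      have hmeet : ((G \ clF N B₀) ∩ (G \ clF N B₁)).Nonempty := by
        by_contra hdis
        rw [Finset.not_nonempty_iff_eq_empty] at hdis
        have hcu : ((G \ clF N B₀) ∪ (G \ clF N B₁)).card = 4 := by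
          rw [Finset.card_union_of_disjoint (Finset.disjoint_iff_inter_eq_empty.2 hdis), hc hB₀ hf₀, hc hB₁ hf₁]
        have := Finset.card_le_card (Finset.subset_union_left (s₁ := (G \ clF N B₀) ∪ (G \ clF N B₁))
          (s₂ := G \ clF N B₂))
        omega
      obtain ⟨p, hp⟩ := hmeet
      obtain ⟨x, y, hP₀, hP₁, hpx, hpy, hxy⟩ := pair_shape_of_mem_inter (hc hB₀ hf₀) (hc hB₁ hf₁) h01 hp
      have hpG : p ∈ G := by
        have : p ∈ G \ clF N B₀ := by rw [hP₀]; simp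
        exact (Finset.mem_sdiff.1 this).1
      have hxG : x ∈ G := by
        have : x ∈ G \ clF N B₀ := by rw [hP₀]; simp
        exact (Finset.mem_sdiff.1 this).1
      have hyG : y ∈ G := by
        have : y ∈ G \ clF N B₁ := by rw [hP₁]; simp
        exact (Finset.mem_sdiff.1 this).1
      have hpK : p ∉ coloops N G := notMem_coloops_of_mem_sdiff_clF hG hd' hB₀ (by rw [hP₀]; simp)
      have hxK : x ∉ coloops N G := notMem_coloops_of_mem_sdiff_clF hG hd' hB₀ (by rw [hP₀]; simp)
      have hyK : y ∉ coloops N G := notMem_coloops_of_mem_sdiff_clF hG hd' hB₁ (by rw [hP₁]; simp)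
      have hH₀ : N.eRk ((G \ {p, x} : Finset α') : Set α') ≤ ((5 : ℕ) : ℕ∞) := by
        have := eRk_clF_le_of_mem_thinMembers hB₀
        rwa [clF_eq_sdiff_sdiff_of_thin hB₀, hP₀] at this
      have hH₁ : N.eRk ((G \ {p, y} : Finset α') : Set α') ≤ ((5 : ℕ) : ℕ∞) := by
        have := eRk_clF_le_of_mem_thinMembers hB₁
        rwa [clF_eq_sdiff_sdiff_of_thin hB₁, hP₁] at this
      have hH₂ : N.eRk ((G \ {x, y} : Finset α') : Set α') ≤ ((5 : ℕ) : ℕ∞) :=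
        eRk_sdiff_pair_le_of_series' hG hH₀ hH₁
          (Finset.sdiff_sdiff_eq_self (Finset.insert_subset hpG (Finset.singleton_subset_iff.2 hxG)))
          (Finset.sdiff_sdiff_eq_self (Finset.insert_subset hpG (Finset.singleton_subset_iff.2 hyG))) hpx hpy hxy hpK
      refine localShadowHall_three_one_five_fifteen_of_triangleFS hG hd hk hcell.1 hcell.2.1 hN hc3 hpx hpy hxy ?_
        hH₀ hH₁ hH₂
      intro a ha
      simp only [Finset.mem_insert, Finset.mem_singleton] at ha
      rcases ha with rfl | rfl | rfl
      · exact hpK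
      · exact hxK
      · exact hyK
  · -- `12 ≤ |G| ≤ 14`
    exact h31 N G hcell hd hk h11 (by omega) hfm cnd3 cb3 cb4 hc3 (fun h => absurd h (by omega))
      (fun _ => hc1215 ⟨hN.1, by omega⟩) (fun h => absurd h (by omega))

end SevenFiveS

end PercRepro.Shadow
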